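import Summits.BirchSwinnertonDyer.BirchSwinnertonDyer.Theorems.ResidualThetaTransportAtTwoSignedMuSeedAtTwoPlusGrasLambdaLayerCertificate
import Summits.BirchSwinnertonDyer.BirchSwinnertonDyer.Theorems.ResidualThetaTransportAtTwoSignedMuSeedAtTwoPlusGrasLambdaTorsionByFinite

/-!
# «`X` is cyclic since `d₀ = 1`»: Nakayama and the cyclic presentation `X ≅ Λ′/J`

Route `ResidualThetaTransportAtTwo`, seed crux `SignedMuSeedAtTwoPlus` (stmt-BirchSwinnertonDyer-21438). Completes the
kernel side of the lead's layer-rank certificate (`…GrasLambdaLayerCertificate`, census k2g14 W8 / k2g16 §2):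
the certificate is stated for CYCLIC modules `X = Λ′/J`, and cyclicity is read off the bottom layer —
«`A₀/2A₀ = X/𝔪X` has `2` elements (`d₀ = 1`) ⟹ `X` is cyclic» — which is Nakayama's lemma:

* `span_singleton_eq_top_of_sup_eq_top` — (any local ring) a lift of a generator of `M/𝔪M` generates `M`
  (`IsLocalRing.map_mkQ_eq_top`);
* `exists_linearEquiv_quotient_of_span_eq_top` — a cyclic module is `≃ R/J`;
* `exists_sup_eq_top_of_card_quotient_le` — if `#(M/𝔪M) ≤ #(R/𝔪)` (and `M/𝔪M` is finite) then `M/𝔪M` is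
  generated by one element (the orbit map `R/𝔪 → M/𝔪M` of a non-zero class is injective, hence bijective);
* `isTorsionBySet_quotient_maximalIdeal_smul`, `finite_quotient_maximalIdeal_smul_powerSeries` — over
  `Λ′ = 𝒪⟦X⟧` (`𝒪` a local PID with finite residue field, not a field) `M/𝔪M` is automatically finite;
* **`exists_linearEquiv_quotient_of_card_le_powerSeries`** — for `M` finitely generated over `Λ′` with
  `#(M/𝔪M) ≤ #(𝒪/𝔪_𝒪)`: `M ≃ Λ′/J` for some ideal `J` (then `…LayerCertificate` applies to `J`).
* (appended) `nonempty_quotient_smul_top_equiv` (`M ≃ R/J ⟹ M/IM ≃ R/(J+I)`) and the assembled certificates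
  `finite_quotient_smul_of_card_layerQuotient_lt_of_linearEquiv` / **`finite_quotient_smul_of_card_layerQuotient_lt`**:
  `#(M/𝔪M) ≤ #k` and `#(M/(ϖ, ω_n)M) < #k^{p^n}` at ONE layer ⟹ `M/ϖM` finite («μ = 0»).

Nothing here proves BSD, the crux or (F); helper lemmas `--supports` the seed item. [folklore]
-/

set_option autoImplicit false
set_option linter.dupNamespace false

namespace Summit.BirchSwinnertonDyer.BirchSwinnertonDyer.Theorems.SignedMuAtTwo.GrasLeopoldt

open PowerSeries IsLocalRing

section LocalRing

variable {R : Type*} [CommRing R] [IsLocalRing R] {M : Type*} [AddCommGroup M] [Module R M]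

/-- **Nakayama: a lift of a generator of `M/𝔪M` generates `M`** (`M` finitely generated over a local ring).
[folklore] -/
theorem span_singleton_eq_top_of_sup_eq_top [Module.Finite R M] (x : M)
    (hx : Submodule.span R {x} ⊔ (maximalIdeal R • ⊤ : Submodule R M) = ⊤) :
    Submodule.span R {x} = ⊤ := by
  apply IsLocalRing.map_mkQ_eq_top.mp
  rw [Submodule.map_mkQ_eq_top, sup_comm]
  exact hx

omit [IsLocalRing R] in
/-- **A cyclic module is a quotient of the ring**: `span {x} = ⊤ ⟹ M ≃ R/J` with `J = Ann(x)`. [folklore] -/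
theorem exists_linearEquiv_quotient_of_span_eq_top (x : M) (hx : Submodule.span R {x} = ⊤) :
    ∃ J : Ideal R, Nonempty ((R ⧸ J) ≃ₗ[R] M) := by
  refine ⟨LinearMap.ker (LinearMap.toSpanSingleton R M x),
    ⟨LinearMap.quotKerEquivOfSurjective _ ?_⟩⟩
  rw [← LinearMap.range_eq_top, LinearMap.range_toSpanSingleton, hx]

/-- **One generator modulo `𝔪` from a cardinality bound.** If `M/𝔪M` is finite with at most `#(R/𝔪)`
elements, then `M = Rx + 𝔪M` for some `x`: either `M/𝔪M = 0`, or for a non-zero class `x̄` the orbit map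
`R/𝔪 → M/𝔪M`, `r ↦ r x̄`, is injective (a non-unit multiple… a unit multiple of `x̄` is non-zero), hence
bijective by counting. (For `R/𝔪 = 𝔽₂`: «`d₀ = 1`».) [folklore] -/
theorem exists_sup_eq_top_of_card_quotient_le
    [Finite (M ⧸ (maximalIdeal R • ⊤ : Submodule R M))]
    (h : Nat.card (M ⧸ (maximalIdeal R • ⊤ : Submodule R M)) ≤ Nat.card (R ⧸ maximalIdeal R)) :
    ∃ x : M, Submodule.span R {x} ⊔ (maximalIdeal R • ⊤ : Submodule R M) = ⊤ := by
  set N : Submodule R M := maximalIdeal R • ⊤ with hN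
  by_cases hQ : Subsingleton (M ⧸ N)
  · refine ⟨0, ?_⟩
    rw [Submodule.Quotient.subsingleton_iff.mp hQ]
    exact sup_top_eq _
  · rw [not_subsingleton_iff_nontrivial] at hQ
    obtain ⟨q, hq⟩ := exists_ne (0 : M ⧸ N)
    obtain ⟨x, rfl⟩ := Submodule.Quotient.mk_surjective N q
    refine ⟨x, ?_⟩
    -- the orbit map `R → M/N`, `r ↦ r • x̄`, kills `𝔪`, so descends to `R/𝔪`
    let φ : R →ₗ[R] M ⧸ N := N.mkQ.comp (LinearMap.toSpanSingleton R M x)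
    have hφ : maximalIdeal R ≤ LinearMap.ker φ := fun r hr => by
      rw [LinearMap.mem_ker]
      show N.mkQ (r • x) = 0
      rw [Submodule.mkQ_apply, Submodule.Quotient.mk_eq_zero]
      exact Submodule.smul_mem_smul hr Submodule.mem_top
    let g : (R ⧸ maximalIdeal R) →ₗ[R] M ⧸ N := Submodule.liftQ _ φ hφ
    -- `g` is injective: `r • x̄ = 0` with `r ∉ 𝔪` would give `x̄ = 0`
    have hginj : Function.Injective g := by
      rw [← LinearMap.ker_eq_bot, eq_bot_iff]
      intro a ha
      obtain ⟨r, rfl⟩ := Submodule.Quotient.mk_surjective _ a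
      rw [LinearMap.mem_ker, Submodule.liftQ_apply] at ha
      change N.mkQ (r • x) = 0 at ha
      rw [Submodule.mkQ_apply, Submodule.Quotient.mk_eq_zero] at ha
      by_contra hr
      have hr' : r ∉ maximalIdeal R := fun h' =>
        hr ((Submodule.mem_bot R).mpr ((Submodule.Quotient.mk_eq_zero _).mpr h'))
      have hu : IsUnit r := by
        by_contra hnu
        exact hr' ((IsLocalRing.mem_maximalIdeal r).mpr hnu)
      obtain ⟨u, rfl⟩ := hu
      apply hq
      rw [Submodule.Quotient.mk_eq_zero]
      have : x = (↑u⁻¹ : R) • ((u : R) • x) := by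
        rw [smul_smul, Units.inv_mul, one_smul]
      rw [this]
      exact N.smul_mem _ ha
    -- hence bijective by counting, in particular surjective
    have hgbij : Function.Bijective g := hginj.bijective_of_nat_card_le h
    rw [Submodule.eq_top_iff']
    intro m
    obtain ⟨a, ha⟩ := hgbij.2 (N.mkQ m)
    obtain ⟨r, rfl⟩ := Submodule.Quotient.mk_surjective _ a
    rw [Submodule.liftQ_apply] at ha
    change N.mkQ (r • x) = N.mkQ m at ha
    rw [Submodule.mkQ_apply, Submodule.mkQ_apply, Submodule.Quotient.eq] at ha
    have hm : m = r • x + -(r • x - m) := by abel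
    rw [hm]
    exact Submodule.add_mem_sup (Submodule.mem_span_singleton.mpr ⟨r, rfl⟩) (N.neg_mem ha)

end LocalRing

section PowerSeriesRing

variable {𝒪 : Type*} [CommRing 𝒪] [IsDomain 𝒪] [IsPrincipalIdealRing 𝒪] [IsLocalRing 𝒪]

/-- `M/𝔪M` is killed by `𝔪`. [folklore] -/
theorem isTorsionBySet_quotient_maximalIdeal_smul {R : Type*} [CommRing R] [IsLocalRing R]
    (M : Type*) [AddCommGroup M] [Module R M] :
    Module.IsTorsionBySet R (M ⧸ (maximalIdeal R • ⊤ : Submodule R M)) (maximalIdeal R) := by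
  rintro z ⟨r, hr⟩
  induction z using Submodule.Quotient.induction_on with
  | H m =>
    show r • Submodule.Quotient.mk m = 0
    rw [← Submodule.Quotient.mk_smul, Submodule.Quotient.mk_eq_zero]
    exact Submodule.smul_mem_smul hr Submodule.mem_top

/-- **`M/𝔪M` is finite** for `M` finitely generated over `Λ′ = 𝒪⟦X⟧` (`𝒪` a local PID with finite residue
field, not a field): `𝔪 ∋ X, C ϖ` is gcd-free, so «pseudo-null ⟹ finite» applies. [folklore] -/
theorem finite_quotient_maximalIdeal_smul_powerSeries [Finite (ResidueField 𝒪)] (h𝒪 : ¬ IsField 𝒪)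
    (M : Type*) [AddCommGroup M] [Module 𝒪⟦X⟧ M] [Module.Finite 𝒪⟦X⟧ M] :
    Finite (M ⧸ (maximalIdeal 𝒪⟦X⟧ • ⊤ : Submodule 𝒪⟦X⟧ M)) := by
  obtain ⟨ϖ, hϖm, hϖ0⟩ : ∃ ϖ ∈ maximalIdeal 𝒪, ϖ ≠ 0 := by
    have hne : maximalIdeal 𝒪 ≠ ⊥ := fun h => h𝒪 (IsLocalRing.isField_iff_maximalIdeal_eq.mpr h)
    exact Submodule.exists_mem_ne_zero_of_ne_bot hne
  have hXm : (PowerSeries.X : 𝒪⟦X⟧) ∈ maximalIdeal 𝒪⟦X⟧ := by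
    rw [mem_maximalIdeal_powerSeries_iff, PowerSeries.constantCoeff_X]
    exact (maximalIdeal 𝒪).zero_mem
  have hCm : (PowerSeries.C ϖ : 𝒪⟦X⟧) ∈ maximalIdeal 𝒪⟦X⟧ := by
    rw [mem_maximalIdeal_powerSeries_iff, PowerSeries.constantCoeff_C]
    exact hϖm
  refine finite_of_isTorsionBySet_gcdFree _ (maximalIdeal 𝒪⟦X⟧)
    (isTorsionBySet_quotient_maximalIdeal_smul M) fun q hq => ?_
  exact isUnit_of_dvd_X_pow_of_dvd_C_pow ϖ hϖ0 1 1 q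
    (by simpa using hq _ hXm) (by simpa using hq _ hCm)

omit [IsDomain 𝒪] [IsPrincipalIdealRing 𝒪] in
/-- `Λ′/𝔪 ≅ 𝒪/𝔪_𝒪` as rings (constant term), hence the same cardinality. [folklore] -/
theorem card_quotient_maximalIdeal_powerSeries :
    Nat.card (𝒪⟦X⟧ ⧸ maximalIdeal 𝒪⟦X⟧) = Nat.card (ResidueField 𝒪) := by
  let φ : 𝒪⟦X⟧ →+* ResidueField 𝒪 := (residue 𝒪).comp constantCoeff
  have hφ : Function.Surjective φ := residue_surjective.comp constantCoeff_surj
  have hker : RingHom.ker φ = maximalIdeal 𝒪⟦X⟧ := by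
    ext f
    rw [RingHom.mem_ker, RingHom.comp_apply, residue_eq_zero_iff, mem_maximalIdeal_powerSeries_iff]
  rw [← hker]
  exact Nat.card_congr (RingHom.quotientKerEquivOfSurjective hφ).toEquiv

/-- **«`X` is cyclic since `d₀ = 1`» over `Λ′ = 𝒪⟦X⟧.** `𝒪` a local PID with finite residue field, not a
field; `M` finitely generated over `Λ′` with `#(M/𝔪M) ≤ #(𝒪/𝔪_𝒪)` (for `𝒪 = ℤ₂`: `dim_{𝔽₂} X/(2,T)X ≤ 1`,
i.e. `d₀ ≤ 1`). Then `M ≃ Λ′/J` for an ideal `J` — the cyclic presentation to which the layer-rank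
certificate `finite_quotient_sup_span_C_of_card_layerQuotient_lt` applies. [folklore] -/
theorem exists_linearEquiv_quotient_of_card_le_powerSeries [Finite (ResidueField 𝒪)] (h𝒪 : ¬ IsField 𝒪)
    (M : Type*) [AddCommGroup M] [Module 𝒪⟦X⟧ M] [Module.Finite 𝒪⟦X⟧ M]
    (h : Nat.card (M ⧸ (maximalIdeal 𝒪⟦X⟧ • ⊤ : Submodule 𝒪⟦X⟧ M)) ≤ Nat.card (ResidueField 𝒪)) :
    ∃ J : Ideal 𝒪⟦X⟧, Nonempty ((𝒪⟦X⟧ ⧸ J) ≃ₗ[𝒪⟦X⟧] M) := by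
  haveI := finite_quotient_maximalIdeal_smul_powerSeries h𝒪 M
  rw [← card_quotient_maximalIdeal_powerSeries] at h
  obtain ⟨x, hx⟩ := exists_sup_eq_top_of_card_quotient_le (R := 𝒪⟦X⟧) (M := M) h
  exact exists_linearEquiv_quotient_of_span_eq_top x (span_singleton_eq_top_of_sup_eq_top x hx)

end PowerSeriesRing

/-! ### Transport to the module and the assembled certificate (appended, same seat) -/

section Transport

variable {R : Type*} [CommRing R]

/-- **Quotients of a cyclic module**: if `M ≃ R/J` then `M/(I·M) ≃ R/(J + I)` for every ideal `I`
(`Submodule.Quotient.equiv`, `Ideal.smul_top_eq_map`, `DoubleQuot.quotQuotEquivQuotSup`). [folklore] -/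
theorem nonempty_quotient_smul_top_equiv (J I : Ideal R) (M : Type*) [AddCommGroup M] [Module R M]
    (e : (R ⧸ J) ≃ₗ[R] M) :
    Nonempty ((M ⧸ (I • ⊤ : Submodule R M)) ≃ (R ⧸ (J ⊔ I))) := by
  have h1 : (I • ⊤ : Submodule R M).map (e.symm : M →ₗ[R] R ⧸ J) = I • ⊤ := by
    rw [Submodule.map_smul'', Submodule.map_top, LinearEquiv.range]
  let e1 : (M ⧸ (I • ⊤ : Submodule R M)) ≃ₗ[R] (R ⧸ J) ⧸ (I • ⊤ : Submodule R (R ⧸ J)) :=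
    Submodule.Quotient.equiv _ _ e.symm h1
  have h2 : (I • ⊤ : Submodule R (R ⧸ J)) = (I.map (Ideal.Quotient.mk J)).restrictScalars R := by
    rw [Ideal.smul_top_eq_map, Ideal.Quotient.algebraMap_eq]
  let e2 : ((R ⧸ J) ⧸ (I • ⊤ : Submodule R (R ⧸ J))) ≃ₗ[R]
      (R ⧸ J) ⧸ ((I.map (Ideal.Quotient.mk J)).restrictScalars R) := Submodule.quotEquivOfEq _ _ h2
  let e3 : ((R ⧸ J) ⧸ ((I.map (Ideal.Quotient.mk J)).restrictScalars R)) ≃ₗ[R]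
      (R ⧸ J) ⧸ (I.map (Ideal.Quotient.mk J)) := Submodule.Quotient.restrictScalarsEquiv R _
  let e4 : ((R ⧸ J) ⧸ (I.map (Ideal.Quotient.mk J))) ≃+* R ⧸ (J ⊔ I) :=
    DoubleQuot.quotQuotEquivQuotSup J I
  exact ⟨e1.toEquiv.trans (e2.toEquiv.trans (e3.toEquiv.trans e4.toEquiv))⟩

end Transport

section Assembled

variable {𝒪 : Type*} [CommRing 𝒪] [IsDomain 𝒪] [IsPrincipalIdealRing 𝒪] [IsLocalRing 𝒪]

/-- **Layer-rank certificate for a cyclic module, module form.** `M ≃ Λ′/J`; if at ONE layer `n` the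
quotient `M/(ϖ, ω_n)M` has fewer than `#(𝒪/ϖ)^{p^n}` elements then `M/ϖM` is finite («`μ(M) = 0`»).
[folklore] -/
theorem finite_quotient_smul_of_card_layerQuotient_lt_of_linearEquiv [Finite (ResidueField 𝒪)]
    (ϖ : 𝒪) (hϖ0 : ϖ ≠ 0) (hϖ : (Ideal.span {ϖ}).IsPrime) (p : ℕ) (hp : p.Prime) (hϖp : ϖ ∣ (p : 𝒪))
    (M : Type*) [AddCommGroup M] [Module 𝒪⟦X⟧ M] (J : Ideal 𝒪⟦X⟧) (e : (𝒪⟦X⟧ ⧸ J) ≃ₗ[𝒪⟦X⟧] M)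
    (n : ℕ)
    (hlt : Nat.card (M ⧸ ((Ideal.span {(C ϖ : 𝒪⟦X⟧)} ⊔
        Ideal.span {(1 + X : 𝒪⟦X⟧) ^ (p ^ n) - 1}) • ⊤ : Submodule 𝒪⟦X⟧ M)) <
        Nat.card (𝒪 ⧸ Ideal.span {ϖ}) ^ (p ^ n)) :
    Finite (M ⧸ (Ideal.span {(C ϖ : 𝒪⟦X⟧)} • ⊤ : Submodule 𝒪⟦X⟧ M)) := by
  obtain ⟨f1⟩ := nonempty_quotient_smul_top_equiv J
    (Ideal.span {(C ϖ : 𝒪⟦X⟧)} ⊔ Ideal.span {(1 + X : 𝒪⟦X⟧) ^ (p ^ n) - 1}) M e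
  obtain ⟨f2⟩ := nonempty_quotient_smul_top_equiv J (Ideal.span {(C ϖ : 𝒪⟦X⟧)}) M e
  rw [Nat.card_congr f1, ← sup_assoc] at hlt
  haveI := finite_quotient_sup_span_C_of_card_layerQuotient_lt ϖ hϖ0 hϖ p hp hϖp J n hlt
  exact Finite.of_equiv _ f2.symm

/-- **Layer-rank certificate, fully assembled** (`𝒪` a local PID with finite residue field, not a field;
`ϖ ≠ 0` generating a prime with `ϖ ∣ p`; `M` finitely generated over `Λ′ = 𝒪⟦X⟧`). If `#(M/𝔪M) ≤ #(𝒪/𝔪_𝒪)`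
(«`d₀ ≤ 1`», so `M` is cyclic) and at ONE layer `n` `#(M/(ϖ, ω_n)M) < #(𝒪/ϖ)^{p^n}` («`d_n < p^n`»), then
`M/ϖM` is FINITE («`μ(M) = 0`»). For `X = X(L_∞/L)` of the census field 406203s1 (`𝒪 = ℤ₂`, `ϖ = p = 2`):
`d₀ = 1`, so `d_4 < 16` certifies `μ₂ = 0` — the kernel half of EPS-CERT; the identification
`A_n/2A_n = X/(2, ω_n)X` is arithmetic and not formalised. [folklore] -/
theorem finite_quotient_smul_of_card_layerQuotient_lt [Finite (ResidueField 𝒪)] (h𝒪 : ¬ IsField 𝒪)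
    (ϖ : 𝒪) (hϖ0 : ϖ ≠ 0) (hϖ : (Ideal.span {ϖ}).IsPrime) (p : ℕ) (hp : p.Prime) (hϖp : ϖ ∣ (p : 𝒪))
    (M : Type*) [AddCommGroup M] [Module 𝒪⟦X⟧ M] [Module.Finite 𝒪⟦X⟧ M]
    (h0 : Nat.card (M ⧸ (maximalIdeal 𝒪⟦X⟧ • ⊤ : Submodule 𝒪⟦X⟧ M)) ≤ Nat.card (ResidueField 𝒪))
    (n : ℕ)
    (hlt : Nat.card (M ⧸ ((Ideal.span {(C ϖ : 𝒪⟦X⟧)} ⊔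
        Ideal.span {(1 + X : 𝒪⟦X⟧) ^ (p ^ n) - 1}) • ⊤ : Submodule 𝒪⟦X⟧ M)) <
        Nat.card (𝒪 ⧸ Ideal.span {ϖ}) ^ (p ^ n)) :
    Finite (M ⧸ (Ideal.span {(C ϖ : 𝒪⟦X⟧)} • ⊤ : Submodule 𝒪⟦X⟧ M)) := by
  obtain ⟨J, ⟨e⟩⟩ := exists_linearEquiv_quotient_of_card_le_powerSeries h𝒪 M h0
  exact finite_quotient_smul_of_card_layerQuotient_lt_of_linearEquiv ϖ hϖ0 hϖ p hp hϖp M J e n hlt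

end Assembled

end Summit.BirchSwinnertonDyer.BirchSwinnertonDyer.Theorems.SignedMuAtTwo.GrasLeopoldt
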